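import Summits.MatrixMultiplication.MatrixMultiplication.Theorems.FarEdgeDescentAnchorLaw
import Mathlib.Analysis.Convex.Mul
import HarnessLib

/-!
# Route `FarEdgeDescent` — THE FIRST OPEN ADDITIVE ORDER DOES NOTHING: an order-3 completely monotone
# far excess with the special-leaf shape and `W(1,1,1) > 2` (N16 decided)
(lens-2 «special vs generic», gen 43, Kernel XVIII; support module for the crux `AnchoredLogConvexity`
stmt-MatrixMultiplication-28900; companion of `FarEdgeDescentLaplaceLaw` / `FarEdgeDescentAnchorLaw`; def-free;
the cut of record `closes (h₁ : FiniteSaturation) (h₂ : AnchoredLogConvexity)` is UNCHANGED)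

`e(x) := ω(1,x,1) − (x+1)`.  BASELINE (critic g15 r2): for the TRUE excess, complete monotonicity holds to
ORDER 2 by tree theorems — `e ≥ 0` (flattening), `Δ_h e ≤ 0` (`FarEdgeDescentChord.excess_antitone`, padding),
`Δ_h² e ≥ 0` (Lotti–Romani convexity) — while the Laplace law of `FarEdgeDescentLaplaceLaw` (ALL orders,
Bernstein) upgrades the special leaf to the summit (`mm_of_finiteSaturation_of_laplace`) and implies every
Hankel minor, in particular the crux `L(1) = AnchoredLogConvexity` (the `2 × 2` minor, MULTIPLICATIVE).  The
first open ADDITIVE order is 3: `Δ_h³ e(x) = e(x+3h) − 3e(x+2h) + 3e(x+h) − e(x) ≤ 0` (far nodes `x ≥ 1`); it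
is necessary (`ω = 2 ⟹ e = 0` on `[1,∞)`), and memo N16 asked whether it UPGRADES THE CUT — can it replace
the crux next to the special leaf (or next to the aside `SuperExpContact`)?  **No**:

* §1 the QUADRATIC KINK `Q(x) = max(K−x,0)²/(K+5)²` (the Williamson / Peano kernel of order 3): convex,
  antitone, nonnegative, cube line; `Δ_h³ Q ≤ 0` for ALL real `x` and `h > 0` (`quadKink_delta3_nonpos`, five
  polynomial cases), while `Q(K) = 0 < Q(1)`.
* §2 `orderThreeWorld`: for every integer `K ≥ 2` a 3D-LAWFUL functional (landed far-tail freedom theorem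
  `FarEdgeDescentTailShadow.farTail_realisable`) with far excess `Q`: `FiniteSaturation`-shape at `K` (hence
  `SuperExpContact`-shape), orders 1, 2 AND 3 of complete monotonicity on the far nodes, `AnchoredLogConvexity`-shape
  FALSE (zero propagation: `Q((1+K)/2) > 0 = Q(K)`), and `W(1,1,1) = 2 + ((K−1)/(K+5))² > 2`.  So order 3 is
  lawful-world-INSUFFICIENT next to the special leaf and next to `SuperExpContact`, and it does NOT imply the crux.
* §3 `orderThree_not_from_crux`: conversely the crux-shape does not imply order 3 — the secant-bent harmonic
  excess `max(1/(4x), (9/2−x)/20)` (chord of `1/(4x)` over `[2, 5/2]`) satisfies `L(1)` and has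
  `Δ³_{1/4} e(2) = 3/880 > 0` at a convex kink; realised as a lawful world with `W(1,1,1) = 9/4`.

DICHOTOMY READING (N16): among additive complete-monotonicity laws of the excess, orders `≤ 2` are FREE
(theorems) and order 3 — indeed every finite order `n`, by the truncated power `(K−x)₊^{n−1}`, typed here for
`n = 3` — is USELESS as a generic partner: compactly supported extreme kernels saturate.  Only order `∞`
(Laplace) or a MULTIPLICATIVE law (a Hankel minor: the crux) propagates zeros from the special leaf to the
square.  The crux is incomparable with order 3 modulo the shape laws; it stays the cheapest usable generic leaf;
leaf tag IDEA-NEEDED unchanged; nothing here proves `ω = 2`.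
[cite: Widder1941, Ch. IV §§12–13 (Bernstein; completely and k-times monotone functions)]
[cite: LottiRomani1983, §2 (p. 174)] [cite: HuangPan1998, §2 eq. (2.5)–(2.8)]
-/

set_option linter.dupNamespace false

noncomputable section

namespace Summit.MatrixMultiplication.MatrixMultiplication.Theorems.FarEdgeDescentHankelOrderThree

open Literature.Computability.AlgebraicComplexity Set
open Summit.MatrixMultiplication.MatrixMultiplication.Theses.FarEdgeDescent
open Summit.MatrixMultiplication.MatrixMultiplication.Theorems.FarEdgeDescentTailShadow
open Summit.MatrixMultiplication.MatrixMultiplication.Theorems.FarEdgeDescentAnchorLaw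

/-! ## §1 The quadratic kink `max(K−x,0)²` — the order-3 Williamson kernel -/

/-- **Third differences of the quadratic kink are non-positive** — for ALL real `x` and `h > 0`:
`p(x+3h)² − 3p(x+2h)² + 3p(x+h)² − p(x)² ≤ 0`, `p = (K−·)₊`.  Five cases in `u = K − x`: `u ≤ 0` gives `0`;
`0 < u ≤ h` gives `−u²`; `h < u ≤ 2h` gives `2u² − 6uh + 3h² ≤ −h²`; `2h < u ≤ 3h` gives `−(u−3h)²`;
`u > 3h` gives `0` (third difference of a quadratic). -/
theorem quadKink_delta3_nonpos (K x : ℝ) {h : ℝ} (hh : 0 < h) :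
    max (K - (x + 3 * h)) 0 ^ 2 - 3 * max (K - (x + 2 * h)) 0 ^ 2 + 3 * max (K - (x + h)) 0 ^ 2 -
      max (K - x) 0 ^ 2 ≤ 0 := by
  rcases le_or_gt (K - x) 0 with h0 | h0
  · rw [max_eq_right h0, max_eq_right (by linarith), max_eq_right (by linarith), max_eq_right (by linarith)]
    norm_num
  rw [max_eq_left h0.le]
  rcases le_or_gt (K - (x + h)) 0 with h1 | h1
  · rw [max_eq_right h1, max_eq_right (by linarith), max_eq_right (by linarith)]
    nlinarith
  rw [max_eq_left h1.le]
  rcases le_or_gt (K - (x + 2 * h)) 0 with h2 | h2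
  · rw [max_eq_right h2, max_eq_right (by linarith)]
    nlinarith
  rw [max_eq_left h2.le]
  rcases le_or_gt (K - (x + 3 * h)) 0 with h3 | h3
  · rw [max_eq_right h3]
    nlinarith
  rw [max_eq_left h3.le]
  nlinarith

/-- Second differences of the quadratic kink are non-negative (all real `x`, `h > 0`). -/
theorem quadKink_delta2_nonneg (K x : ℝ) {h : ℝ} (hh : 0 < h) :
    0 ≤ max (K - (x + 2 * h)) 0 ^ 2 - 2 * max (K - (x + h)) 0 ^ 2 + max (K - x) 0 ^ 2 := by
  rcases le_or_gt (K - x) 0 with h0 | h0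
  · rw [max_eq_right h0, max_eq_right (by linarith), max_eq_right (by linarith)]
    norm_num
  rw [max_eq_left h0.le]
  rcases le_or_gt (K - (x + h)) 0 with h1 | h1
  · rw [max_eq_right h1, max_eq_right (by linarith)]
    nlinarith
  rw [max_eq_left h1.le]
  rcases le_or_gt (K - (x + 2 * h)) 0 with h2 | h2
  · rw [max_eq_right h2]
    nlinarith
  rw [max_eq_left h2.le]
  nlinarith

/-- First differences of the quadratic kink are non-positive (all real `x`, `h > 0`). -/
theorem quadKink_delta1_nonpos (K x : ℝ) {h : ℝ} (hh : 0 < h) :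
    max (K - (x + h)) 0 ^ 2 - max (K - x) 0 ^ 2 ≤ 0 := by
  have h1 : max (K - (x + h)) 0 ≤ max (K - x) 0 := max_le_max (by linarith) le_rfl
  have h2 : 0 ≤ max (K - (x + h)) 0 := le_max_right _ _
  nlinarith [pow_le_pow_left₀ h2 h1 2]

/-- The quadratic kink vanishes at and beyond `K`. -/
theorem quadKink_eq_zero {K x : ℝ} (hx : K ≤ x) : max (K - x) 0 ^ 2 = 0 := by
  rw [max_eq_right (by linarith)]
  norm_num

/-- The quadratic kink is positive before `K`. -/
theorem quadKink_pos {K x : ℝ} (hx : x < K) : 0 < max (K - x) 0 ^ 2 := by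
  rw [max_eq_left (by linarith)]
  nlinarith

/-! ## §2 The order-three world -/

/-- **The order-three world** (N16 decided negatively).  For every integer `K ≥ 2` there is a 3D-LAWFUL
functional `W` (symmetric, positively homogeneous, subadditive, monotone in the middle argument, sandwiched)
with far excess `max(K−x,0)²/(K+5)²`: the special-leaf shape holds at `K` and `SuperExpContact`-shape holds;
the far excess is completely monotone TO ORDER 3 (first, second and third differences signed on all far
nodes); the crux-shape `L(1)` FAILS; and `W(1,1,1) = 2 + ((K−1)/(K+5))² > 2`. -/
theorem orderThreeWorld (K : ℕ) (hK : 2 ≤ K) :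
    ∃ W : ℝ → ℝ → ℝ → ℝ,
      ((∀ x y z : ℝ, W x y z = W y x z ∧ W x y z = W x z y) ∧
        (∀ ν : ℝ, 0 < ν → ∀ x y z : ℝ, 0 < x → 0 < y → 0 < z →
          W (ν * x) (ν * y) (ν * z) = ν * W x y z) ∧
        (∀ x y z x' y' z' : ℝ, 0 < x → 0 < y → 0 < z → 0 < x' → 0 < y' → 0 < z' →
          W (x + x') (y + y') (z + z') ≤ W x y z + W x' y' z') ∧
        (∀ x y y' z : ℝ, 0 < x → 0 < y → y ≤ y' → 0 < z → W x y z ≤ W x y' z) ∧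
        (∀ x y z : ℝ, 0 < x → 0 < y → 0 < z →
          max (x + z) (max (x + y) (y + z)) ≤ W x y z ∧ W x y z ≤ x + y + z)) ∧
      (∃ K' : ℕ, 2 ≤ K' ∧ W 1 K' 1 = K' + 1) ∧
      (∀ ρ : ℝ, 0 < ρ → ∃ k : ℕ, 2 ≤ k ∧ W 1 k 1 - (k + 1) < ρ ^ k) ∧
      (∀ x h : ℝ, 1 ≤ x → 0 < h → W 1 (x + h) 1 - (x + h + 1) ≤ W 1 x 1 - (x + 1)) ∧
      (∀ x h : ℝ, 1 ≤ x → 0 < h →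
        0 ≤ (W 1 (x + 2 * h) 1 - (x + 2 * h + 1)) - 2 * (W 1 (x + h) 1 - (x + h + 1)) + (W 1 x 1 - (x + 1))) ∧
      (∀ x h : ℝ, 1 ≤ x → 0 < h →
        (W 1 (x + 3 * h) 1 - (x + 3 * h + 1)) - 3 * (W 1 (x + 2 * h) 1 - (x + 2 * h + 1)) +
            3 * (W 1 (x + h) 1 - (x + h + 1)) - (W 1 x 1 - (x + 1)) ≤ 0) ∧
      (¬ ∀ m : ℝ, 1 < m → (W 1 m 1 - (m + 1)) ^ 2 ≤ (W 1 1 1 - 2) * (W 1 (2 * m - 1) 1 - 2 * m)) ∧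
      W 1 1 1 = 2 + ((K - 1) / (K + 5)) ^ 2 := by
  have hK1 : (1 : ℝ) < K := by exact_mod_cast (by omega : 1 < K)
  set s : ℝ := 1 / ((K : ℝ) + 5) ^ 2 with hs_def
  have hs : 0 < s := by rw [hs_def]; positivity
  set g : ℝ → ℝ := fun x => s • (fun y : ℝ => max ((K : ℝ) - y) 0) x ^ 2 with hg_def
  have hg : ∀ x, g x = s * max ((K : ℝ) - x) 0 ^ 2 := fun x => by simp [hg_def, smul_eq_mul]
  have hconv : ConvexOn ℝ (Ici 1) g := by
    have h1 : ConvexOn ℝ (Ici (1 : ℝ)) (fun y : ℝ => (K : ℝ) - y) :=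
      (convexOn_const (𝕜 := ℝ) (K : ℝ) (convex_Ici (1 : ℝ))).sub (concaveOn_id (convex_Ici (1 : ℝ)))
    have h2 : ConvexOn ℝ (Ici (1 : ℝ)) (fun y : ℝ => max ((K : ℝ) - y) 0) :=
      h1.sup (convexOn_const (𝕜 := ℝ) (0 : ℝ) (convex_Ici (1 : ℝ)))
    have h3 : ConvexOn ℝ (Ici (1 : ℝ)) ((fun y : ℝ => max ((K : ℝ) - y) 0) ^ 2) :=
      h2.pow (fun y _ => le_max_right _ _) 2
    have h4 : ConvexOn ℝ (Ici (1 : ℝ)) (fun x : ℝ => s • ((fun y : ℝ => max ((K : ℝ) - y) 0) ^ 2) x) :=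
      h3.smul hs.le
    rw [hg_def]
    exact h4
  have hanti : AntitoneOn g (Ici 1) := by
    intro x _ y _ hxy
    rw [hg, hg]
    have h1 : max ((K : ℝ) - y) 0 ≤ max ((K : ℝ) - x) 0 := max_le_max (by linarith) le_rfl
    exact mul_le_mul_of_nonneg_left (pow_le_pow_left₀ (le_max_right _ _) h1 2) hs.le
  have hnn : ∀ x : ℝ, 1 ≤ x → 0 ≤ g x := fun x _ => by rw [hg]; positivity
  have hg1 : g 1 = s * ((K : ℝ) - 1) ^ 2 := by rw [hg, max_eq_left (by linarith)]
  have hcube : ∀ x : ℝ, 1 ≤ x → g 1 - g x ≤ (1 - g 1) / 3 * (x - 1) := by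
    intro x hx
    -- `g 1 − g x ≤ 2 s (K−1)(x−1)` and `6 s (K−1) + 3·(that) ≤ …`: the constant `s = 1/(K+5)²` is small enough
    have key : ((K : ℝ) - 1) ^ 2 - max ((K : ℝ) - x) 0 ^ 2 ≤ 2 * ((K : ℝ) - 1) * (x - 1) := by
      rcases le_total ((K : ℝ) - x) 0 with h | h
      · rw [max_eq_right h]; nlinarith
      · rw [max_eq_left h]; nlinarith
    have hsK : s * (((K : ℝ) - 1) * ((K : ℝ) + 5)) ≤ 1 := by
      rw [hs_def, div_mul_eq_mul_div, one_mul, div_le_one (by positivity)]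
      nlinarith
    rw [hg1, hg]
    nlinarith [mul_le_mul_of_nonneg_left key hs.le, mul_nonneg hs.le (sub_nonneg.2 hx)]
  obtain ⟨W, hsym, hhom, hsub, hmono, hsand, hfar, hone⟩ := farTail_realisable hconv hanti hnn hcube
  have hexc : ∀ x : ℝ, 1 ≤ x → W 1 x 1 - (x + 1) = s * max ((K : ℝ) - x) 0 ^ 2 := fun x hx => by
    rw [hfar x hx, hg]; ring
  have hsatK : W 1 K 1 = K + 1 := by
    have := hexc K hK1.le
    rw [max_eq_right (by linarith : (K : ℝ) - K ≤ 0)] at this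
    linarith
  refine ⟨W, ⟨hsym, hhom, hsub, hmono, hsand⟩, ⟨K, hK, hsatK⟩, ?_, ?_, ?_, ?_, ?_, ?_⟩
  · -- `SuperExpContact`-shape: the saturated length `K` beats every `ρ^K > 0`
    intro ρ hρ
    exact ⟨K, hK, by rw [hsatK]; simpa using pow_pos hρ K⟩
  · intro x h hx hh
    rw [hexc (x + h) (by linarith), hexc x hx]
    nlinarith [mul_le_mul_of_nonneg_left (le_of_sub_nonpos (quadKink_delta1_nonpos (K : ℝ) x hh)) hs.le]
  · intro x h hx hh
    rw [hexc (x + 2 * h) (by linarith), hexc (x + h) (by linarith), hexc x hx]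
    nlinarith [mul_nonneg hs.le (quadKink_delta2_nonneg (K : ℝ) x hh)]
  · intro x h hx hh
    rw [hexc (x + 3 * h) (by linarith), hexc (x + 2 * h) (by linarith), hexc (x + h) (by linarith), hexc x hx]
    nlinarith [mul_le_mul_of_nonneg_left (quadKink_delta3_nonpos (K : ℝ) x hh) hs.le]
  · -- the crux-shape fails: zero propagation from `K` back to `(1+K)/2`
    intro hL
    have key := hL ((1 + K) / 2) (by linarith)
    have e1 : W 1 1 1 - 2 = s * ((K : ℝ) - 1) ^ 2 := by
      have := hexc 1 le_rfl
      rw [max_eq_left (by linarith : (0 : ℝ) ≤ K - 1)] at this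
      linarith
    have e2 : W 1 (2 * ((1 + K) / 2) - 1) 1 - 2 * ((1 + (K : ℝ)) / 2) = 0 := by
      have := hexc (2 * ((1 + K) / 2) - 1) (by linarith)
      rw [max_eq_right (by linarith : (K : ℝ) - (2 * ((1 + K) / 2) - 1) ≤ 0)] at this
      linarith
    have e3 : W 1 ((1 + K) / 2) 1 - ((1 + (K : ℝ)) / 2 + 1) = s * (((K : ℝ) - 1) / 2) ^ 2 := by
      have := hexc ((1 + K) / 2) (by linarith)
      rw [max_eq_left (by linarith : (0 : ℝ) ≤ K - (1 + K) / 2)] at this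
      linarith
    rw [e1, e2, e3, mul_zero] at key
    have : 0 < s * (((K : ℝ) - 1) / 2) ^ 2 := by
      have : 0 < ((K : ℝ) - 1) / 2 := by linarith
      positivity
    nlinarith
  · rw [hone, hg1, hs_def]
    field_simp

/-- **Reading (N16).**  Order 3 upgrades nothing: there is a lawful world with the special-leaf shape, the
`SuperExpContact`-shape, the order-3 law on all far nodes, `¬ AnchoredLogConvexity`-shape and `W(1,1,1) > 2`
— whereas `FiniteSaturation ∧ AnchoredLogConvexity` is the summit (`closes`) and the Laplace law (all orders)
gives `FiniteSaturation → ω = 2` (`FarEdgeDescentLaplaceLaw.mm_of_finiteSaturation_of_laplace`). -/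
theorem orderThree_upgrades_nothing :
    ∃ W : ℝ → ℝ → ℝ → ℝ,
      ((∀ x y z : ℝ, W x y z = W y x z ∧ W x y z = W x z y) ∧
        (∀ ν : ℝ, 0 < ν → ∀ x y z : ℝ, 0 < x → 0 < y → 0 < z →
          W (ν * x) (ν * y) (ν * z) = ν * W x y z) ∧
        (∀ x y z x' y' z' : ℝ, 0 < x → 0 < y → 0 < z → 0 < x' → 0 < y' → 0 < z' →
          W (x + x') (y + y') (z + z') ≤ W x y z + W x' y' z') ∧
        (∀ x y y' z : ℝ, 0 < x → 0 < y → y ≤ y' → 0 < z → W x y z ≤ W x y' z) ∧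
        (∀ x y z : ℝ, 0 < x → 0 < y → 0 < z →
          max (x + z) (max (x + y) (y + z)) ≤ W x y z ∧ W x y z ≤ x + y + z)) ∧
      (∃ K : ℕ, 2 ≤ K ∧ W 1 K 1 = K + 1) ∧
      (∀ ρ : ℝ, 0 < ρ → ∃ k : ℕ, 2 ≤ k ∧ W 1 k 1 - (k + 1) < ρ ^ k) ∧
      (∀ x h : ℝ, 1 ≤ x → 0 < h →
        (W 1 (x + 3 * h) 1 - (x + 3 * h + 1)) - 3 * (W 1 (x + 2 * h) 1 - (x + 2 * h + 1)) +
            3 * (W 1 (x + h) 1 - (x + h + 1)) - (W 1 x 1 - (x + 1)) ≤ 0) ∧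
      (¬ ∀ m : ℝ, 1 < m → (W 1 m 1 - (m + 1)) ^ 2 ≤ (W 1 1 1 - 2) * (W 1 (2 * m - 1) 1 - 2 * m)) ∧
      2 < W 1 1 1 := by
  obtain ⟨W, hlaws, hfin, hsec, -, -, h3, hnot, hone⟩ := orderThreeWorld 2 le_rfl
  refine ⟨W, hlaws, hfin, hsec, h3, hnot, ?_⟩
  rw [hone]
  norm_num

/-! ## §3 … and the crux-shape does not give order 3 -/

/-- **A convex kink has a positive third difference.**  For the secant-bent harmonic excess
`E(x) = max(1/(4x), (9/2 − x)/20)` (chord of `1/(4x)` over `[2, 5/2]`):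
`E(11/4) − 3E(5/2) + 3E(9/4) − E(2) = 1/11 − 3/10 + 27/80 − 1/8 = 3/880 > 0`. -/
theorem bent_delta3_pos :
    0 < max (1 / (4 * (11 / 4 : ℝ))) ((9 / 2 - 11 / 4) / 20) - 3 * max (1 / (4 * (5 / 2 : ℝ))) ((9 / 2 - 5 / 2) / 20) +
      3 * max (1 / (4 * (9 / 4 : ℝ))) ((9 / 2 - 9 / 4) / 20) - max (1 / (4 * (2 : ℝ))) ((9 / 2 - 2) / 20) := by
  rw [max_eq_left (by norm_num : ((9 : ℝ) / 2 - 11 / 4) / 20 ≤ 1 / (4 * (11 / 4))),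
    max_eq_left (by norm_num : ((9 : ℝ) / 2 - 5 / 2) / 20 ≤ 1 / (4 * (5 / 2))),
    max_eq_right (by norm_num : 1 / (4 * (9 / 4 : ℝ)) ≤ (9 / 2 - 9 / 4) / 20),
    max_eq_left (by norm_num : ((9 : ℝ) / 2 - 2) / 20 ≤ 1 / (4 * 2))]
  norm_num

/-- The secant-bent excess `max(1/(4x), (9/2−x)/20)` satisfies the crux-shape `L(1)`: for every `m > 1`,
`E(m)² ≤ E(1)·E(2m−1)` with `E(1) = 1/4` (off the chord: `(m−1)² ≥ 0`; on the chord `[2, 5/2]`: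
`E(m) ≤ 1/8` and `2m − 1 ≤ 4`). -/
theorem bent_anchoredLaw_one {m : ℝ} (hm : 1 < m) :
    max (1 / (4 * m)) ((9 / 2 - m) / 20) ^ 2 ≤
      max (1 / (4 * (1 : ℝ))) ((9 / 2 - 1) / 20) * max (1 / (4 * (2 * m - 1))) ((9 / 2 - (2 * m - 1)) / 20) := by
  rw [max_eq_left (by norm_num : ((9 : ℝ) / 2 - 1) / 20 ≤ 1 / (4 * 1))]
  have hm0 : 0 < m := by linarith
  have h2m : 0 < 2 * m - 1 := by linarith
  have hR : 1 / (4 * (1 : ℝ)) * (1 / (4 * (2 * m - 1))) ≤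
      1 / (4 * (1 : ℝ)) * max (1 / (4 * (2 * m - 1))) ((9 / 2 - (2 * m - 1)) / 20) :=
    mul_le_mul_of_nonneg_left (le_max_left _ _) (by norm_num)
  refine le_trans ?_ hR
  have h16 : 0 < 16 * (2 * m - 1) := by positivity
  rw [show 1 / (4 * (1 : ℝ)) * (1 / (4 * (2 * m - 1))) = 1 / (16 * (2 * m - 1)) by field_simp; ring]
  rcases le_total ((9 / 2 - m) / 20) (1 / (4 * m)) with h | h
  · rw [max_eq_left h, show (1 / (4 * m)) ^ 2 = 1 / (16 * m ^ 2) by field_simp; ring]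
    exact one_div_le_one_div_of_le h16 (by nlinarith [sq_nonneg (m - 1)])
  · rw [max_eq_right h]
    have hprod : 5 ≤ m * (9 / 2 - m) := by
      have := (div_le_div_iff₀ (by positivity) (by positivity)).1 h
      nlinarith
    have hbm : 2 ≤ m := by nlinarith
    have hmc : m ≤ 5 / 2 := by nlinarith
    have hl0 : 0 ≤ (9 / 2 - m) / 20 := le_trans (by positivity) h
    have hl1 : (9 / 2 - m) / 20 ≤ 1 / 8 := by
      rw [div_le_div_iff₀ (by positivity) (by positivity)]
      nlinarith
    calc ((9 / 2 - m) / 20) ^ 2 ≤ (1 / 8) ^ 2 := pow_le_pow_left₀ hl0 hl1 2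
      _ = 1 / 64 := by norm_num
      _ ≤ 1 / (16 * (2 * m - 1)) := one_div_le_one_div_of_le h16 (by nlinarith)

/-- **The crux-shape does not give order 3** (lawful world).  A 3D-lawful `W` with far excess
`max(1/(4x), (9/2−x)/20)`: `AnchoredLogConvexity`-shape HOLDS, the order-3 law FAILS at the nodes
`2, 9/4, 5/2, 11/4`, and `W(1,1,1) = 9/4`.  With `orderThreeWorld`: the crux and the order-3 law are
INCOMPARABLE modulo the shape laws. -/
theorem orderThree_not_from_crux :
    ∃ W : ℝ → ℝ → ℝ → ℝ,
      ((∀ x y z : ℝ, W x y z = W y x z ∧ W x y z = W x z y) ∧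
        (∀ ν : ℝ, 0 < ν → ∀ x y z : ℝ, 0 < x → 0 < y → 0 < z →
          W (ν * x) (ν * y) (ν * z) = ν * W x y z) ∧
        (∀ x y z x' y' z' : ℝ, 0 < x → 0 < y → 0 < z → 0 < x' → 0 < y' → 0 < z' →
          W (x + x') (y + y') (z + z') ≤ W x y z + W x' y' z') ∧
        (∀ x y y' z : ℝ, 0 < x → 0 < y → y ≤ y' → 0 < z → W x y z ≤ W x y' z) ∧
        (∀ x y z : ℝ, 0 < x → 0 < y → 0 < z →
          max (x + z) (max (x + y) (y + z)) ≤ W x y z ∧ W x y z ≤ x + y + z)) ∧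
      (∀ m : ℝ, 1 < m → (W 1 m 1 - (m + 1)) ^ 2 ≤ (W 1 1 1 - 2) * (W 1 (2 * m - 1) 1 - 2 * m)) ∧
      0 < (W 1 (2 + 3 * (1 / 4)) 1 - (2 + 3 * (1 / 4) + 1)) - 3 * (W 1 (2 + 2 * (1 / 4)) 1 - (2 + 2 * (1 / 4) + 1)) +
          3 * (W 1 (2 + 1 / 4) 1 - (2 + 1 / 4 + 1)) - (W 1 2 1 - (2 + 1)) ∧
      W 1 1 1 = 9 / 4 := by
  -- the bent excess as data for the far-tail freedom theorem
  have hconv : ConvexOn ℝ (Ici (1 : ℝ)) (fun x : ℝ => max (1 / (4 * x)) ((9 / 2 - x) / 20)) := by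
    have hinv : ConvexOn ℝ (Ioi (0 : ℝ)) (fun x : ℝ => x⁻¹) := by
      simpa [zpow_neg, zpow_one] using
        (convexOn_zpow (-1) : ConvexOn ℝ (Ioi (0 : ℝ)) fun x : ℝ => x ^ (-1 : ℤ))
    have h1 : ConvexOn ℝ (Ioi (0 : ℝ)) (fun x : ℝ => (1 / 4 : ℝ) • x⁻¹) := hinv.smul (by norm_num)
    have h2 : ConvexOn ℝ (Ici (1 : ℝ)) (fun x : ℝ => (1 / 4 : ℝ) • x⁻¹) :=
      h1.subset (fun x (hx : 1 ≤ x) => show (0 : ℝ) < x by linarith) (convex_Ici _)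
    have h3 : ConvexOn ℝ (Ici (1 : ℝ)) (fun x : ℝ => 1 / (4 * x)) := by
      refine h2.congr fun x hx => ?_
      have hx0 : (0 : ℝ) < x := lt_of_lt_of_le one_pos hx
      simp only [smul_eq_mul]
      field_simp
    have h4 : ConvexOn ℝ (Ici (1 : ℝ)) (fun x : ℝ => (9 / 2 - x) / 20) := by
      refine ⟨convex_Ici 1, ?_⟩
      intro x _ y _ p q _ _ hpq
      obtain rfl : q = 1 - p := by linarith
      simp only [smul_eq_mul]
      apply le_of_eq
      ring
    exact h3.sup h4
  have hanti : AntitoneOn (fun x : ℝ => max (1 / (4 * x)) ((9 / 2 - x) / 20)) (Ici (1 : ℝ)) := by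
    intro x hx y _ hxy
    have hx1 : (1 : ℝ) ≤ x := hx
    exact max_le_max (one_div_le_one_div_of_le (by linarith) (by linarith))
      (div_le_div_of_nonneg_right (by linarith) (by norm_num))
  have hpos : ∀ x : ℝ, 0 < x → 0 < max (1 / (4 * x)) ((9 / 2 - x) / 20) := fun x hx =>
    lt_of_lt_of_le (by positivity) (le_max_left _ _)
  have hone' : max (1 / (4 * (1 : ℝ))) ((9 / 2 - 1) / 20) = 1 / 4 := by
    rw [max_eq_left (by norm_num : ((9 : ℝ) / 2 - 1) / 20 ≤ 1 / (4 * (1 : ℝ)))]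
    norm_num
  have hcube : ∀ x : ℝ, 1 ≤ x →
      max (1 / (4 * (1 : ℝ))) ((9 / 2 - 1) / 20) - max (1 / (4 * x)) ((9 / 2 - x) / 20) ≤
        (1 - max (1 / (4 * (1 : ℝ))) ((9 / 2 - 1) / 20)) / 3 * (x - 1) := by
    intro x hx
    rw [hone']
    have hx0 : 0 < x := by linarith
    have h1 : 1 / (4 * x) ≤ max (1 / (4 * x)) ((9 / 2 - x) / 20) := le_max_left _ _
    have h2 : 1 / 4 - 1 / (4 * x) ≤ (x - 1) / 4 := by
      rw [show (1 : ℝ) / 4 - 1 / (4 * x) = (x - 1) / (4 * x) by field_simp]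
      exact div_le_div_of_nonneg_left (by linarith) (by norm_num) (by linarith)
    linarith
  obtain ⟨W, hsym, hhom, hsub, hmono, hsand, hfar, hone⟩ :=
    farTail_realisable (e := fun x : ℝ => max (1 / (4 * x)) ((9 / 2 - x) / 20)) hconv hanti
      (fun x hx => (hpos x (by linarith)).le) hcube
  have hexc : ∀ x : ℝ, 1 ≤ x → W 1 x 1 - (x + 1) = max (1 / (4 * x)) ((9 / 2 - x) / 20) :=
    fun x hx => by rw [hfar x hx]; ring
  have hW1 : W 1 1 1 = 9 / 4 := by
    rw [hone]
    show 2 + max (1 / (4 * (1 : ℝ))) ((9 / 2 - 1) / 20) = 9 / 4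
    rw [hone']
    norm_num
  refine ⟨W, ⟨hsym, hhom, hsub, hmono, hsand⟩, ?_, ?_, hW1⟩
  · intro m hm
    have e1 : W 1 1 1 - 2 = max (1 / (4 * (1 : ℝ))) ((9 / 2 - 1) / 20) := by rw [hW1, hone']; norm_num
    have e2 : W 1 (2 * m - 1) 1 - 2 * m = max (1 / (4 * (2 * m - 1))) ((9 / 2 - (2 * m - 1)) / 20) := by
      rw [← hexc (2 * m - 1) (by linarith)]
      ring
    rw [hexc m hm.le, e1, e2]
    exact bent_anchoredLaw_one hm
  · rw [show (2 : ℝ) + 3 * (1 / 4) = 11 / 4 by norm_num, show (2 : ℝ) + 2 * (1 / 4) = 5 / 2 by norm_num,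
      show (2 : ℝ) + 1 / 4 = 9 / 4 by norm_num, hexc (11 / 4) (by norm_num), hexc (5 / 2) (by norm_num),
      hexc (9 / 4) (by norm_num), hexc 2 (by norm_num)]
    exact bent_delta3_pos

end Summit.MatrixMultiplication.MatrixMultiplication.Theorems.FarEdgeDescentHankelOrderThree

end
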